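import Summits.RiemannHypothesis.RiemannHypothesis.Theorems.MotivicDoorArchResidualKernelSharp
import HarnessLib

/-!
# Motivic door (Connes–Consani): the decree off the diagonal — transport and the additive side

Honest framing (cell `pub-rhdoor`, cc-3, verbatim): "lottery ticket at the motivic door; RH
probability negligible; consolation prizes are real: a new semi-local Weil-positivity theorem, or a
located gap in the Connes–Consani programme, plus the ff-door theorem".  No RH content below;
value = theorem.

Connes–Consani decree the intersection pairing of divisors on the square of the Scaling Site by
`D • D' := ⟨D ⋆ D̃', Δ⟩`, i.e. on test functions `𝔰(f, g) := N(f ⋆ g̃)` (`ccPairing`, `ccN`,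
`mulConv`, `mulReflect` of `Literature.NumberTheory.ConnesConsani2019.RiemannRochStrategy`;
Connes, arXiv:1509.05576 eq. (17)–(18); Connes–Consani, arXiv:1805.10501 §3.1 eq. (16)).  The tree
so far treats the DIAGONAL `𝔰(f, f)` (`two_mul_ccPairing_toMul_eq`:
`2𝔰(f,f) = Re Σ_Λ(k) − Re W_ℝ(k)`, `k = u ⋆ ũ`).  This file transports the OFF-DIAGONAL pairing
to the additive picture and computes `N` there for an arbitrary (not necessarily even) real
test `κ`:

PROVED (RH-free, elementary):
* `mulConv_toMul_mulReflect_toMul_cross`, `ccPairing_toMul_toMul`, `ccPairing_toMul_toMul_swap`: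
  for `f = toMul u`, `g = toMul w`: `f ⋆ g̃ = toMul κ_{u,w}` with the cross-correlation
  `κ_{u,w}(t) = ∫ u(s) w(s − t) ds = (u ⋆ w̃)(t)` (`weilConv_ofReal_weilReflect_ofReal`), hence
  `𝔰(f, g) = N(toMul κ_{u,w})` and `𝔰(g, f) = N(toMul κ_{u,w}(−·))`; `κ_{u,w}` is a Weil test
  (`isWeilTest_crossCorr`) supported in `[a₁ − b₂, b₁ − a₂]` when `supp u ⊆ [a₁, b₁]`,
  `supp w ⊆ [a₂, b₂]` (`crossCorr_eq_zero_of_windows`).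
* `two_mul_ccN_toMul`: `2N(toMul κ) = 2ΣΛ(n)n^{-1/2}κ(log n)
  + ∫₀^∞ [(e^{t/2}2κ(t) − 2κ(0))/(2 sinh t) + 2κ(0)/(e^t+1)] dt + (log π + γ)κ(0)` for EVERY
  real `κ` (change of variables `u = e^t`; the tree's `two_mul_ccN_toMul_eq` is the even case).
* `ccN_toMul_eq_zero_of_forall`: `N(toMul κ) = 0` if `κ` vanishes on `[0, ∞)` — `N` charges only
  `u ≥ 1`.  `ccN_toMul_eq_setIntegral`: if `κ` vanishes off `(0, log 2)` then
  `N(toMul κ) = ∫₀^∞ e^{t/2}κ(t)/(2 sinh t) dt` (no prime power has `log n < log 2`).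
* `massDstar_toMul_eq`, `massDu_toMul_eq` (`∫ h d^*u = ∫ e^{−t/2}κ`, `∫ h du = ∫ e^{t/2}κ`),
  `massDstar_toMul_le_ccN` (`N(h) ≥ ∫ h d^*u` for `h = toMul κ`, `κ ≥ 0` supported in `(0, log 2)`:
  `e^{t/2}/(2 sinh t) ≥ e^{−t/2}`), `massDstar_toMul_pos`, `massDu_toMul_pos`.

The companion file `MotivicDoorDecreeAsymmetry` draws the consequences: the symmetrisation
identity `𝔰(f,g) + 𝔰(g,f) = Re Σ_Λ(u ⋆ w̃) − Re W_ℝ(u ⋆ w̃)` and the ASYMMETRY of the decree as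
printed (`𝔰(g, f) = 0 < 𝔰(f, g)` for suitable bumps).

References: Bombieri 2000 (Thm 2); Connes, arXiv:1509.05576 §3.1 eq. (17)–(18), §4.1 eq. (27);
Connes–Consani, arXiv:1805.10501 §3.1 eq. (15)–(17).
-/

noncomputable section

set_option linter.dupNamespace false

open Complex Set MeasureTheory Filter Topology Literature.NumberTheory.LFunctions
open Literature.NumberTheory.ConnesConsani2019
open Summit.RiemannHypothesis.RiemannHypothesis.Theorems.MotivicDoor.ArchLogLaplacian
open scoped Real ComplexConjugate ArithmeticFunction.vonMangoldt

namespace Summit.RiemannHypothesis.RiemannHypothesis.Theorems.MotivicDoor.ConnesConsani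

/-! ## 1. Transport of the cross term: `toMul u ⋆ (toMul w)~ = toMul κ_{u,w}` -/

section Transport

variable (u w : ℝ → ℝ)

/-- For real `u, w` the cross-correlation `(u ⋆ w̃)(t) = ∫ u(s) w(s − t) ds` is real.  PROVED. -/
theorem weilConv_ofReal_weilReflect_ofReal (t : ℝ) :
    weilConv (fun s ↦ (u s : ℂ)) (weilReflect fun s ↦ (w s : ℂ)) t =
      ((∫ s, u s * w (s - t) : ℝ) : ℂ) := by
  rw [weilConv_apply, ← integral_complex_ofReal]
  refine integral_congr_ae (Eventually.of_forall fun s ↦ ?_)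
  simp only [weilReflect, Complex.conj_ofReal, neg_sub]
  push_cast
  ring

/-- **Cross transport**: `(toMul u) ⋆ (toMul w)~ = toMul κ` on `ℝ₊^*`, `κ(t) = ∫ u(s) w(s − t) ds`
(the case `u = w` is the tree's `mulConv_toMul_mulReflect_toMul`).  PROVED. -/
theorem mulConv_toMul_mulReflect_toMul_cross {x : ℝ} (hx : 0 < x) :
    mulConv (toMul u) (mulReflect (toMul w)) x = toMul (fun t ↦ ∫ s, u s * w (s - t)) x := by
  simp only [mulConv]
  rw [setIntegral_Ioi_zero_eq_integral_exp]
  have hpt : ∀ t : ℝ, Real.exp t * (toMul u (Real.exp t) * mulReflect (toMul w) (x / Real.exp t) /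
      Real.exp t) = x ^ (-(1 / 2 : ℝ)) * (u t * w (t - Real.log x)) := by
    intro t
    have he : 0 < Real.exp t := Real.exp_pos t
    have hq : 0 < x / Real.exp t := div_pos hx he
    rw [mulReflect_toMul w hq]
    simp only [toMul]
    rw [Real.log_exp, Real.log_div hx.ne' he.ne', Real.log_exp, Real.div_rpow hx.le he.le, neg_sub]
    have hne : Real.exp t ^ (-(1 / 2 : ℝ)) ≠ 0 := (Real.rpow_pos_of_pos he _).ne'
    have hne' : Real.exp t ≠ 0 := he.ne'
    field_simp
  simp_rw [hpt, integral_const_mul]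
  simp only [toMul]

/-- **`𝔰(f, g) = N(toMul κ_{u,w})`** for `f = toMul u`, `g = toMul w`,
`κ_{u,w}(t) = ∫ u(s) w(s − t) ds`.  PROVED. -/
theorem ccPairing_toMul_toMul :
    ccPairing (toMul u) (toMul w) = ccN (toMul fun t ↦ ∫ s, u s * w (s - t)) := by
  rw [ccPairing, ccN_congr (fun x hx ↦ mulConv_toMul_mulReflect_toMul_cross u w hx)]

/-- `κ_{w,u}(t) = κ_{u,w}(−t)`.  PROVED. -/
private theorem integral_mul_sub_swap (t : ℝ) : ∫ s, w s * u (s - t) = ∫ s, u s * w (s - (-t)) := by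
  have h : ∫ s, u (s - t) * w (s - t - (-t)) = ∫ s, u s * w (s - (-t)) :=
    integral_sub_right_eq_self (fun r ↦ u r * w (r - (-t))) t
  rw [← h]
  refine integral_congr_ae (Eventually.of_forall fun s ↦ ?_)
  show w s * u (s - t) = u (s - t) * w (s - t - (-t))
  rw [sub_neg_eq_add, sub_add_cancel, mul_comm]

/-- **`𝔰(g, f) = N(toMul κ_{u,w}(−·))`**: the transposed pairing pairs `N` with the reflected
cross-correlation.  PROVED. -/
theorem ccPairing_toMul_toMul_swap :
    ccPairing (toMul w) (toMul u) = ccN (toMul fun t ↦ ∫ s, u s * w (s - (-t))) := by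
  have h : (fun t ↦ ∫ s, w s * u (s - t)) = fun t ↦ ∫ s, u s * w (s - (-t)) :=
    funext fun t ↦ integral_mul_sub_swap u w t
  rw [ccPairing_toMul_toMul w u, h]

variable {u w}

/-- The cross-correlation of real Weil tests is (the real form of) a Weil test.  PROVED. -/
theorem isWeilTest_crossCorr (hu : IsWeilTest fun t ↦ (u t : ℂ))
    (hw : IsWeilTest fun t ↦ (w t : ℂ)) :
    IsWeilTest fun t ↦ ((∫ s, u s * w (s - t) : ℝ) : ℂ) := by
  have e : (fun t ↦ ((∫ s, u s * w (s - t) : ℝ) : ℂ)) =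
      weilConv (fun s ↦ (u s : ℂ)) (weilReflect fun s ↦ (w s : ℂ)) :=
    funext fun t ↦ (weilConv_ofReal_weilReflect_ofReal u w t).symm
  rw [e]
  exact hu.weilConv hw.weilReflect

/-- **Support of the cross-correlation**: if `supp u ⊆ [a₁, b₁]` and `supp w ⊆ [a₂, b₂]` then
`κ_{u,w}(t) = 0` off `[a₁ − b₂, b₁ − a₂]`.  PROVED. -/
theorem crossCorr_eq_zero_of_windows (hu : IsWeilTest fun t ↦ (u t : ℂ)) {a₁ b₁ a₂ b₂ : ℝ}
    (hsu : tsupport (fun t ↦ (u t : ℂ)) ⊆ Icc a₁ b₁)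
    (hsw : tsupport (fun t ↦ (w t : ℂ)) ⊆ Icc a₂ b₂)
    {t : ℝ} (ht : t < a₁ - b₂ ∨ b₁ - a₂ < t) : ∫ s, u s * w (s - t) = 0 := by
  have hmem : t ∉ tsupport (weilConv (fun s ↦ (u s : ℂ)) (weilReflect fun s ↦ (w s : ℂ))) := by
    intro hmem
    have h := tsupport_weilConv_subset hu.2 hmem
    rw [tsupport_weilReflect] at h
    obtain ⟨x, hx, y, hy, hxy⟩ := h
    have hx' := hsu hx
    have hy' : -y ∈ Icc a₂ b₂ := hsw (by simpa using hy)
    simp only [mem_Icc] at hx' hy'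
    rcases ht with ht | ht <;> linarith
  have h0 := image_eq_zero_of_notMem_tsupport hmem
  rw [weilConv_ofReal_weilReflect_ofReal] at h0
  exact_mod_cast h0

end Transport

/-! ## 2. `N` on the additive side, for an arbitrary real test `κ` -/

section Additive

variable (κ : ℝ → ℝ)

/-- **`2N(toMul κ)`, additively** (`u = e^t`; no parity assumed on `κ`):
`2N(toMul κ) = 2Σ Λ(n) n^{-1/2} κ(log n)
  + ∫₀^∞ [(e^{t/2}2κ(t) − 2κ(0))/(2 sinh t) + 2κ(0)/(e^t + 1)] dt + (log π + γ) κ(0)`.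
PROVED (pure change of variables, `two_mul_ccIntegrand_eq`). -/
theorem two_mul_ccN_toMul (κ : ℝ → ℝ) :
    2 * ccN (toMul κ) =
      2 * (∑' n : ℕ, Λ n * toMul κ n) +
        (∫ t in Ioi (0 : ℝ), ((Real.exp (t / 2) * (2 * κ t) - 2 * κ 0) / (2 * Real.sinh t) +
          2 * κ 0 / (Real.exp t + 1))) +
        (Real.log π + Real.eulerMascheroniConstant) * κ 0 := by
  have hcongr : ∫ t in Ioi (0 : ℝ), 2 * (Real.exp t * ((Real.exp t ^ 2 * toMul κ (Real.exp t) -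
      toMul κ 1) / (Real.exp t ^ 2 - 1) / Real.exp t)) =
      ∫ t in Ioi (0 : ℝ), ((Real.exp (t / 2) * (2 * κ t) - 2 * κ 0) / (2 * Real.sinh t) +
        2 * κ 0 / (Real.exp t + 1)) :=
    setIntegral_congr_fun measurableSet_Ioi fun t ht ↦ two_mul_ccIntegrand_eq κ ht
  unfold ccN
  rw [setIntegral_Ioi_one_eq_setIntegral_exp, mul_add, mul_add, ← integral_const_mul, hcongr,
    toMul_one]
  ring

/-- **`N(toMul κ) = 0` when `κ` vanishes on `[0, ∞)`**: `N` charges only `u ≥ 1`.  PROVED. -/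
theorem ccN_toMul_eq_zero_of_forall (h : ∀ t, 0 ≤ t → κ t = 0) : ccN (toMul κ) = 0 := by
  have h1 : toMul κ 1 = 0 := by rw [toMul_one]; exact h 0 le_rfl
  have hs : (fun n : ℕ ↦ Λ n * toMul κ n) = fun _ ↦ 0 := by
    funext n
    rcases Nat.eq_zero_or_pos n with rfl | hn
    · simp
    · have hlog : 0 ≤ Real.log n :=
        Real.log_nonneg ((Nat.one_le_cast (α := ℝ)).2 (Nat.one_le_of_lt hn))
      rw [toMul_natCast κ hn, h _ hlog, zero_div, mul_zero]
  have hi : ∫ v in Ioi (1 : ℝ), (v ^ 2 * toMul κ v - toMul κ 1) / (v ^ 2 - 1) / v =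
      ∫ v in Ioi (1 : ℝ), (0 : ℝ) := by
    refine setIntegral_congr_fun measurableSet_Ioi fun v hv ↦ ?_
    have hv1 : (1 : ℝ) < v := hv
    have hv' : toMul κ v = 0 := by
      simp only [toMul]
      rw [h _ (Real.log_nonneg hv1.le), mul_zero]
    simp only [hv', h1, mul_zero, sub_self, zero_div]
  unfold ccN
  rw [hs, tsum_zero, hi, h1]
  simp

/-- **The window formula**: if `κ` vanishes on `(−∞, 0]` and on `[log 2, ∞)` then
`N(toMul κ) = ∫₀^∞ e^{t/2} κ(t)/(2 sinh t) dt` (no prime power has `log n ∈ (0, log 2)`,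
`κ(0) = 0`).  PROVED. -/
theorem ccN_toMul_eq_setIntegral (h0 : ∀ t, t ≤ 0 → κ t = 0) (h2 : ∀ t, Real.log 2 ≤ t → κ t = 0) :
    ccN (toMul κ) = ∫ t in Ioi (0 : ℝ), Real.exp (t / 2) * κ t / (2 * Real.sinh t) := by
  have hκ0 : κ 0 = 0 := h0 0 le_rfl
  have hs : (fun n : ℕ ↦ Λ n * toMul κ n) = fun _ ↦ 0 := by
    funext n
    rcases Nat.lt_or_ge n 2 with hn | hn
    · interval_cases n
      · simp
      · simp [hκ0]
    · have hn' : 0 < n := by omega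
      have hlog : Real.log 2 ≤ Real.log n := Real.log_le_log two_pos (by exact_mod_cast hn)
      rw [toMul_natCast κ hn', h2 _ hlog, zero_div, mul_zero]
  have h := two_mul_ccN_toMul κ
  have hI : ∫ t in Ioi (0 : ℝ), ((Real.exp (t / 2) * (2 * κ t) - 2 * κ 0) / (2 * Real.sinh t) +
      2 * κ 0 / (Real.exp t + 1)) =
      2 * ∫ t in Ioi (0 : ℝ), Real.exp (t / 2) * κ t / (2 * Real.sinh t) := by
    rw [← integral_const_mul]
    refine setIntegral_congr_fun measurableSet_Ioi fun t _ ↦ ?_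
    rw [hκ0]
    ring
  rw [hs, tsum_zero, hI, hκ0] at h
  linarith

/-- Integrability of the one-sided CC integrand `(e^{t/2}·2κ(t) − 2κ(0))/(2 sinh t)` on `(0, ∞)`
(real part of `ArchLogLaplacian.integrableOn_bombieriIntegrand`).  PROVED. -/
theorem integrableOn_ccArchIntegrand (hκ : IsWeilTest fun t ↦ (κ t : ℂ)) :
    IntegrableOn (fun t ↦ (Real.exp (t / 2) * (2 * κ t) - 2 * κ 0) / (2 * Real.sinh t))
      (Ioi 0) := by
  have h := ((ArchLogLaplacian.integrableOn_bombieriIntegrand hκ).re).const_mul 2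
  refine IntegrableOn.congr_fun h (fun t _ ↦ ?_) measurableSet_Ioi
  rw [RCLike.re_to_complex]
  have e : ((Real.exp (t / 2) : ℂ) * (κ t : ℂ) - (κ 0 : ℂ)) / (2 * Real.sinh t : ℂ) =
      (((Real.exp (t / 2) * κ t - κ 0) / (2 * Real.sinh t) : ℝ) : ℂ) := by
    push_cast
    ring
  rw [e, Complex.ofReal_re]
  ring

/-- Integrability of the window integrand when `κ(0) = 0`.  PROVED. -/
theorem integrableOn_ccWindowIntegrand (hκ : IsWeilTest fun t ↦ (κ t : ℂ)) (hκ0 : κ 0 = 0) :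
    IntegrableOn (fun t ↦ Real.exp (t / 2) * κ t / (2 * Real.sinh t)) (Ioi 0) := by
  have h := (ArchLogLaplacian.integrableOn_bombieriIntegrand hκ).re
  refine IntegrableOn.congr_fun h (fun t _ ↦ ?_) measurableSet_Ioi
  rw [RCLike.re_to_complex, hκ0]
  have e : ((Real.exp (t / 2) : ℂ) * (κ t : ℂ) - ((0 : ℝ) : ℂ)) / (2 * Real.sinh t : ℂ) =
      ((Real.exp (t / 2) * κ t / (2 * Real.sinh t) : ℝ) : ℂ) := by
    push_cast
    ring
  rw [e, Complex.ofReal_re]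

/-- `∫ h d^*u = ∫ e^{-t/2} κ(t) dt` for `h = toMul κ`.  PROVED. -/
theorem massDstar_toMul_eq (κ : ℝ → ℝ) : massDstar (toMul κ) = ∫ t, Real.exp (-(t / 2)) * κ t := by
  simp only [massDstar]
  rw [setIntegral_Ioi_zero_eq_integral_exp]
  refine integral_congr_ae (Eventually.of_forall fun t ↦ ?_)
  dsimp only
  rw [toMul_exp]
  have he : Real.exp t ≠ 0 := (Real.exp_pos t).ne'
  field_simp

/-- **`N(h) ≥ ∫ h d^*u` for `h = toMul κ`, `κ ≥ 0` supported in `(0, log 2)`**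
(`e^{t/2}/(2 sinh t) ≥ e^{-t/2}` for `t > 0`).  PROVED. -/
theorem massDstar_toMul_le_ccN (hκ : IsWeilTest fun t ↦ (κ t : ℂ)) (hnn : ∀ t, 0 ≤ κ t)
    (h0 : ∀ t, t ≤ 0 → κ t = 0) (h2 : ∀ t, Real.log 2 ≤ t → κ t = 0) :
    massDstar (toMul κ) ≤ ccN (toMul κ) := by
  have hκc : Continuous κ := by
    have : κ = fun t ↦ (Complex.reCLM ((κ t : ℂ))) := by funext t; simp
    rw [this]
    exact Complex.reCLM.continuous.comp hκ.1.continuous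
  have hκs : HasCompactSupport κ := by
    have : κ = fun t ↦ (Complex.reCLM ((κ t : ℂ))) := by funext t; simp
    rw [this]
    exact hκ.2.comp_left (g := fun z : ℂ ↦ Complex.reCLM z) (by simp)
  have hzero : ∀ t, t ∉ Ioi (0 : ℝ) → Real.exp (-(t / 2)) * κ t = 0 := fun t ht ↦ by
    rw [h0 t (not_lt.1 ht), mul_zero]
  rw [ccN_toMul_eq_setIntegral κ h0 h2, massDstar_toMul_eq,
    ← setIntegral_eq_integral_of_forall_compl_eq_zero hzero]
  have hc : Continuous fun t ↦ Real.exp (-(t / 2)) * κ t := by fun_prop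
  refine setIntegral_mono_on (hc.integrable_of_hasCompactSupport hκs.mul_left).integrableOn
    (integrableOn_ccWindowIntegrand κ hκ (h0 0 le_rfl)) measurableSet_Ioi fun t ht ↦ ?_
  have ht' : (0 : ℝ) < t := ht
  have hs : 0 < 2 * Real.sinh t := by have := Real.sinh_pos_iff.2 ht'; positivity
  rw [le_div_iff₀ hs]
  have key : Real.exp (-(t / 2)) * (2 * Real.sinh t) ≤ Real.exp (t / 2) := by
    rw [Real.sinh_eq]
    have e1 : Real.exp (-(t / 2)) * Real.exp t = Real.exp (t / 2) := by
      rw [← Real.exp_add]; ring_nf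
    have e2 : 0 ≤ Real.exp (-(t / 2)) * Real.exp (-t) := by positivity
    have e3 : Real.exp (-(t / 2)) * (2 * ((Real.exp t - Real.exp (-t)) / 2)) =
        Real.exp (-(t / 2)) * Real.exp t - Real.exp (-(t / 2)) * Real.exp (-t) := by ring
    rw [e3, e1]
    linarith
  calc Real.exp (-(t / 2)) * κ t * (2 * Real.sinh t)
      = Real.exp (-(t / 2)) * (2 * Real.sinh t) * κ t := by ring
    _ ≤ Real.exp (t / 2) * κ t := mul_le_mul_of_nonneg_right key (hnn t)

/-- `∫ h d^*u > 0` for `h = toMul κ`, `κ ≥ 0`, `κ ≢ 0`.  PROVED. -/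
theorem massDstar_toMul_pos (hκ : IsWeilTest fun t ↦ (κ t : ℂ)) (hnn : ∀ t, 0 ≤ κ t) {t₀ : ℝ}
    (ht₀ : κ t₀ ≠ 0) : 0 < massDstar (toMul κ) := by
  have hκc : Continuous κ := by
    have : κ = fun t ↦ (Complex.reCLM ((κ t : ℂ))) := by funext t; simp
    rw [this]
    exact Complex.reCLM.continuous.comp hκ.1.continuous
  have hκs : HasCompactSupport κ := by
    have : κ = fun t ↦ (Complex.reCLM ((κ t : ℂ))) := by funext t; simp
    rw [this]
    exact hκ.2.comp_left (g := fun z : ℂ ↦ Complex.reCLM z) (by simp)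
  rw [massDstar_toMul_eq]
  have hc : Continuous fun t ↦ Real.exp (-(t / 2)) * κ t := by fun_prop
  exact hc.integral_pos_of_hasCompactSupport_nonneg_nonzero (x := t₀) hκs.mul_left
    (fun t ↦ mul_nonneg (Real.exp_pos _).le (hnn t)) (mul_ne_zero (Real.exp_pos _).ne' ht₀)

/-- `∫ h du = ∫ e^{t/2} κ(t) dt` for `h = toMul κ`.  PROVED. -/
theorem massDu_toMul_eq (κ : ℝ → ℝ) : massDu (toMul κ) = ∫ t, Real.exp (t / 2) * κ t := by
  simp only [massDu]
  rw [setIntegral_Ioi_zero_eq_integral_exp]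
  refine integral_congr_ae (Eventually.of_forall fun t ↦ ?_)
  dsimp only
  rw [toMul_exp, ← mul_assoc, ← Real.exp_add, show t + -(t / 2) = t / 2 by ring]

/-- `∫ h du > 0` for `h = toMul κ`, `κ ≥ 0`, `κ ≢ 0`.  PROVED. -/
theorem massDu_toMul_pos (hκ : IsWeilTest fun t ↦ (κ t : ℂ)) (hnn : ∀ t, 0 ≤ κ t) {t₀ : ℝ}
    (ht₀ : κ t₀ ≠ 0) : 0 < massDu (toMul κ) := by
  have hκc : Continuous κ := by
    have : κ = fun t ↦ (Complex.reCLM ((κ t : ℂ))) := by funext t; simp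
    rw [this]
    exact Complex.reCLM.continuous.comp hκ.1.continuous
  have hκs : HasCompactSupport κ := by
    have : κ = fun t ↦ (Complex.reCLM ((κ t : ℂ))) := by funext t; simp
    rw [this]
    exact hκ.2.comp_left (g := fun z : ℂ ↦ Complex.reCLM z) (by simp)
  rw [massDu_toMul_eq]
  have hc : Continuous fun t ↦ Real.exp (t / 2) * κ t := by fun_prop
  exact hc.integral_pos_of_hasCompactSupport_nonneg_nonzero (x := t₀) hκs.mul_left
    (fun t ↦ mul_nonneg (Real.exp_pos _).le (hnn t)) (mul_ne_zero (Real.exp_pos _).ne' ht₀)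

end Additive

end Summit.RiemannHypothesis.RiemannHypothesis.Theorems.MotivicDoor.ConnesConsani
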